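import Mathlib

/-!
# PercRepro — the arithmetic of the rigid cell at every `q` (night-2, gen 18)

`proofs/NIGHT-2-g18.md` §7: for the rigid cell `(|E ∖ G|, kColoops) = (q−1, q−2)` over an arbitrary plane
`V = G ∖ K` with `n` points, the fair-share loss routing (`Night2LocalRuleLossFair`) reduces the local form
(LI_G) to the inequality

  `n(n−1)(n−2)·(2q²+q−4) ≤ 6·((3q+4)·A₃(n) + q(q²+q−1)(n+1))`,   `A₃(n) = 2^n − 2n − 2 − C(n,2) − C(n,3)`,

(`rigidA n`, `rigid_ineq`): the left side is `n(n−1)(n−2)` times the loss denominator `3λ·q(q+1)²`-normalised,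
the right side the residual capacities of the `C(n−3, j−3)` targets of size `j` (`c′ = (3q+4)/(q(q+1)²)` for
`j ≤ n−2`, `c″ = (q²+q−1)/(q+1)²` for `j ≥ n−1`) — see the paper for the derivation.  **`rigid_ineq`** proves it for
every `n ≥ 5` and `q ≥ 4`: for `n ≥ 8` through `108(n+1)·A₃(n) ≥ 6(n+1)N + N²` with `N = n(n−1)(n−2)`
(`rigidA_bound`, induction on the recursion `A₃(n+1) = 2A₃(n) + n + C(n,3)`), which makes the quadratic
`6(n+1)q² − 2Nq + 18A₃ − N` nonnegative; for `n = 5, 6, 7` through three cubics in `q`.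
-/

namespace PercRepro.Shadow.Rigid

/-- `rigidA n = 2^n − 2n − 2 − n(n−1)/2 − n(n−1)(n−2)/6`. -/
def rigidA (n : ℕ) : ℚ :=
  (2 : ℚ) ^ n - 2 * (n : ℚ) - 2 - (n : ℚ) * ((n : ℚ) - 1) / 2 - (n : ℚ) * ((n : ℚ) - 1) * ((n : ℚ) - 2) / 6

/-- `N n = n(n−1)(n−2)`. -/
def rigidN (n : ℕ) : ℚ := (n : ℚ) * ((n : ℚ) - 1) * ((n : ℚ) - 2)

/-- The recursion `rigidA (n+1) = 2 rigidA n + n + N n / 6`. -/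
theorem rigidA_succ (n : ℕ) : rigidA (n + 1) = 2 * rigidA n + (n : ℚ) + rigidN n / 6 := by
  unfold rigidA rigidN
  push_cast
  ring

/-- `rigidA 8 = 154`. -/
theorem rigidA_eight : rigidA 8 = 154 := by unfold rigidA; norm_num

/-- `rigidA 9 = 372`. -/
theorem rigidA_nine : rigidA 9 = 372 := by unfold rigidA; norm_num

/-- `108(n+1)·A₃(n) ≥ 6(n+1)N + N²` for `n ≥ 9` (induction from `n = 9`). -/
theorem rigidA_bound_nine {n : ℕ} (hn : 9 ≤ n) :
    6 * ((n : ℚ) + 1) * rigidN n + rigidN n ^ 2 ≤ 108 * ((n : ℚ) + 1) * rigidA n := by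
  induction n, hn using Nat.le_induction with
  | base => rw [rigidA_nine]; unfold rigidN; norm_num
  | succ m hm ih =>
    rw [rigidA_succ]
    have hm' : (9 : ℚ) ≤ (m : ℚ) := by exact_mod_cast hm
    unfold rigidN at ih ⊢
    push_cast
    -- multiply the goal by (m+1) > 0 and use ih: the difference is a polynomial in m − 9 with nonnegative coefficients
    have h1 : (0 : ℚ) < (m : ℚ) + 1 := by linarith
    have hA : rigidA m ≥ (6 * ((m : ℚ) + 1) * ((m : ℚ) * ((m : ℚ) - 1) * ((m : ℚ) - 2)) +
        ((m : ℚ) * ((m : ℚ) - 1) * ((m : ℚ) - 2)) ^ 2) / (108 * ((m : ℚ) + 1)) := by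
      rw [ge_iff_le, div_le_iff₀ (by positivity)]
      linarith [ih]
    have hkey : 0 ≤ (m : ℚ) - 9 := by linarith
    have hp : 0 ≤ ((m : ℚ) - 9) ^ 2 := sq_nonneg _
    have hp3 : 0 ≤ ((m : ℚ) - 9) ^ 3 := pow_nonneg hkey 3
    have hp4 : 0 ≤ ((m : ℚ) - 9) ^ 4 := pow_nonneg hkey 4
    have hp5 : 0 ≤ ((m : ℚ) - 9) ^ 5 := pow_nonneg hkey 5
    have hp6 : 0 ≤ ((m : ℚ) - 9) ^ 6 := pow_nonneg hkey 6
    have hp7 : 0 ≤ ((m : ℚ) - 9) ^ 7 := pow_nonneg hkey 7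
    nlinarith [mul_le_mul_of_nonneg_left hA (by positivity : (0 : ℚ) ≤ 108 * ((m : ℚ) + 2) * 2 * ((m : ℚ) + 1)),
      hkey, hp, hp3, hp4, hp5, hp6, hp7]

/-- `108(n+1)·A₃(n) ≥ 6(n+1)N + N²` for `n ≥ 8`. -/
theorem rigidA_bound {n : ℕ} (hn : 8 ≤ n) :
    6 * ((n : ℚ) + 1) * rigidN n + rigidN n ^ 2 ≤ 108 * ((n : ℚ) + 1) * rigidA n := by
  rcases (by omega : n = 8 ∨ 9 ≤ n) with rfl | h9
  · rw [rigidA_eight]; unfold rigidN; norm_num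
  · exact rigidA_bound_nine h9

/-- `rigidA n ≥ 0` for `n ≥ 5`. -/
theorem rigidA_nonneg {n : ℕ} (hn : 5 ≤ n) : 0 ≤ rigidA n := by
  induction n, hn using Nat.le_induction with
  | base => unfold rigidA; norm_num
  | succ m hm ih =>
    rw [rigidA_succ]
    have hm' : (5 : ℚ) ≤ (m : ℚ) := by exact_mod_cast hm
    unfold rigidN
    have hN : (0 : ℚ) ≤ (m : ℚ) * ((m : ℚ) - 1) * ((m : ℚ) - 2) :=
      mul_nonneg (mul_nonneg (by linarith) (by linarith)) (by linarith)
    nlinarith [ih, hm', hN]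

/-- The rigid inequality for `n ≥ 8`. -/
theorem rigid_ineq_large {n q : ℕ} (hn : 8 ≤ n) (hq : 4 ≤ q) :
    rigidN n * (2 * (q : ℚ) ^ 2 + (q : ℚ) - 4) ≤
      6 * ((3 * (q : ℚ) + 4) * rigidA n + (q : ℚ) * ((q : ℚ) ^ 2 + (q : ℚ) - 1) * ((n : ℚ) + 1)) := by
  have hnq : (8 : ℚ) ≤ (n : ℚ) := by exact_mod_cast hn
  have hqq : (4 : ℚ) ≤ (q : ℚ) := by exact_mod_cast hq
  have hA0 : 0 ≤ rigidA n := rigidA_nonneg (by omega)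
  have hB := rigidA_bound hn
  have hq0 : (0 : ℚ) ≤ (q : ℚ) := by linarith
  have hN : 0 ≤ rigidN n := by
    unfold rigidN
    exact mul_nonneg (mul_nonneg (by linarith) (by linarith)) (by linarith)
  -- the quadratic 6(n+1)q² − 2Nq + 18A − N ≥ 0 from the bound (complete the square)
  have hquad : 0 ≤ 6 * ((n : ℚ) + 1) * (q : ℚ) ^ 2 - 2 * rigidN n * (q : ℚ) + 18 * rigidA n - rigidN n := by
    have h1 : (0 : ℚ) < 6 * ((n : ℚ) + 1) := by positivity
    have hsq := sq_nonneg (6 * ((n : ℚ) + 1) * (q : ℚ) - rigidN n)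
    nlinarith [hsq, hB, h1]
  -- 2q²+q−4 ≤ q(2q+1) and the cubic term dominates 6q³(n+1)
  nlinarith [hquad, hA0, hN, hqq, mul_nonneg hN hq0, mul_nonneg hA0 hq0,
    mul_nonneg (mul_nonneg hq0 hq0) (by linarith : (0 : ℚ) ≤ (n : ℚ) + 1),
    mul_nonneg hq0 hquad, mul_nonneg (mul_nonneg hq0 hq0) (by linarith : (0 : ℚ) ≤ (q : ℚ) - 1)]

/-- The rigid inequality for `n = 5`: `36q³ − 84q² − 96q + 240 ≥ 0`. -/
theorem rigid_ineq_five {q : ℕ} (hq : 4 ≤ q) :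
    rigidN 5 * (2 * (q : ℚ) ^ 2 + (q : ℚ) - 4) ≤
      6 * ((3 * (q : ℚ) + 4) * rigidA 5 + (q : ℚ) * ((q : ℚ) ^ 2 + (q : ℚ) - 1) * ((5 : ℕ) + 1 : ℚ)) := by
  have hqq : (4 : ℚ) ≤ (q : ℚ) := by exact_mod_cast hq
  unfold rigidN rigidA
  norm_num
  nlinarith [sq_nonneg ((q : ℚ) - 4), mul_nonneg (by linarith : (0 : ℚ) ≤ (q : ℚ) - 4) (sq_nonneg ((q : ℚ) - 4)),
    mul_nonneg (by linarith : (0 : ℚ) ≤ (q : ℚ) - 4) (by linarith : (0 : ℚ) ≤ (q : ℚ))]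

/-- The rigid inequality for `n = 6`: `42q³ − 198q² + 108q + 840 ≥ 0`. -/
theorem rigid_ineq_six {q : ℕ} (hq : 4 ≤ q) :
    rigidN 6 * (2 * (q : ℚ) ^ 2 + (q : ℚ) - 4) ≤
      6 * ((3 * (q : ℚ) + 4) * rigidA 6 + (q : ℚ) * ((q : ℚ) ^ 2 + (q : ℚ) - 1) * ((6 : ℕ) + 1 : ℚ)) := by
  have hqq : (4 : ℚ) ≤ (q : ℚ) := by exact_mod_cast hq
  unfold rigidN rigidA
  norm_num
  nlinarith [sq_nonneg ((q : ℚ) - 4), mul_nonneg (by linarith : (0 : ℚ) ≤ (q : ℚ) - 4) (sq_nonneg ((q : ℚ) - 4)),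
    mul_nonneg (by linarith : (0 : ℚ) ≤ (q : ℚ) - 4) (by linarith : (0 : ℚ) ≤ (q : ℚ))]

/-- The rigid inequality for `n = 7`: `48q³ − 372q² + 750q + 2184 ≥ 0`. -/
theorem rigid_ineq_seven {q : ℕ} (hq : 4 ≤ q) :
    rigidN 7 * (2 * (q : ℚ) ^ 2 + (q : ℚ) - 4) ≤
      6 * ((3 * (q : ℚ) + 4) * rigidA 7 + (q : ℚ) * ((q : ℚ) ^ 2 + (q : ℚ) - 1) * ((7 : ℕ) + 1 : ℚ)) := by
  have hqq : (4 : ℚ) ≤ (q : ℚ) := by exact_mod_cast hq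
  unfold rigidN rigidA
  norm_num
  nlinarith [sq_nonneg ((q : ℚ) - 4), mul_nonneg (by linarith : (0 : ℚ) ≤ (q : ℚ) - 4) (sq_nonneg ((q : ℚ) - 4)),
    mul_nonneg (by linarith : (0 : ℚ) ≤ (q : ℚ) - 4) (by linarith : (0 : ℚ) ≤ (q : ℚ))]

/-- **The rigid inequality** `(8′)` of `proofs/NIGHT-2-g18.md` §7 for every `n ≥ 5` and `q ≥ 4`. -/
theorem rigid_ineq {n q : ℕ} (hn : 5 ≤ n) (hq : 4 ≤ q) :
    rigidN n * (2 * (q : ℚ) ^ 2 + (q : ℚ) - 4) ≤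
      6 * ((3 * (q : ℚ) + 4) * rigidA n + (q : ℚ) * ((q : ℚ) ^ 2 + (q : ℚ) - 1) * ((n : ℚ) + 1)) := by
  rcases (by omega : n = 5 ∨ n = 6 ∨ n = 7 ∨ 8 ≤ n) with rfl | rfl | rfl | h8
  · have := rigid_ineq_five hq; push_cast at this ⊢; exact this
  · have := rigid_ineq_six hq; push_cast at this ⊢; exact this
  · have := rigid_ineq_seven hq; push_cast at this ⊢; exact this
  · exact rigid_ineq_large h8 hq

end PercRepro.Shadow.Rigid
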